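import Mathlib
import Summits.Ventures.HodgeRepro2.T5HodgeStar
import Summits.Ventures.HodgeRepro2.T5KahlerModel
import Summits.Ventures.HodgeRepro2.T5CoframeInvariance
import Summits.Ventures.HodgeRepro2.T5WedgeDeterminant
import Summits.Ventures.HodgeRepro2.T5HodgeStarEquivariance

/-!
# T5ComplexLinearChange — a complex-linear change of the coframe preserves the `(p,q)`-types and the
complex orientation, and a unitary one also preserves `ω`, the metric and the Hodge operator
(Tier-5 N1 Hodge-side support, seat p6)

Model of `T5HodgeStar` / `T5KahlerModel` / `T5HodgeStarEquivariance`: a complex 2-covector at a point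
of a complex surface is its six coefficients in the real coframe `(dx₁, dy₁, dx₂, dy₂)` of a complex
coframe `(dz₁, dz₂)`, `dz_k = dx_k + i dy_k`. A complex-linear change `dz'_j = Σ_k A_jk dz_k`
(`A ∈ GL₂(ℂ)`) is the real change `f' = realify A · f` of the real coframe, and the coefficients of a
2-covector written in the NEW coframe are carried to the old one by `(Λ² realify A)ᵀ` =
`act (realify A)ᵀ`.

What is kernel-checked here:
* `realify` is a ring homomorphism `M₂(ℂ) → M₄(ℝ)` compatible with `ᴴ ↦ ᵀ` (`realify_mul`,
  `realify_one`, `realify_conjTranspose`), so a unitary `A` gives an orthogonal `realify A`;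
* `det_realify`: `det (realify A) = |det A|²` — every complex-linear change is orientation-preserving:
  «it is canonically oriented» (Voisin p0063 l. 23; the abstract form is row 25,
  `T5ComplexOrientation.det_realBasis`), and a unitary change has `det = 1`;
* `act_realify_dz12`: `dz'_1 ∧ dz'_2 = det A · dz_1 ∧ dz_2` — the `(2,0)`-line of the model is the
  same for every complex coframe;
* `act_realify_oneOne`: `Σ c_ij dz'_i ∧ dz̄'_j = Σ (Aᵀ c Ā)_kl dz_k ∧ dz̄_l` — the `(1,1)`-type is
  preserved; hence the type decomposition depends only on the complex structure;
* `act_realify_kahler`: for unitary `A`, `ω = (i/2) Σ dz'_k ∧ dz̄'_k` is the same covector — the Kähler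
  form of the model depends only on the hermitian metric;
* `hodgeStar_act_realify`: for unitary `A`, the Hodge operator is unchanged
  (`T5HodgeStarEquivariance.hodgeStar_act` with `det = 1`), and `herm_act_realify`;
* `herm_act_realify_twoZero`: for ANY `A`, the hermitian product of two `(2,0)`-covectors scales by
  `det (realify A)`, as `Vol` does — `(α, β)_s Vol_s` is metric-independent on `(2,0)`-covectors
  (§H2.2).

Together with rows 40 / 45 (the metric) and `T5HodgeStarEquivariance` (the operator `*` under `O(4)`)
this closes the well-definedness of the model of §H1–H2.1 of route/T5-N1-hodge-p6.md: nothing in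
`hodgeStar`, `herm`, `kahler`, `twoZero`, `oneOne` depends on the unitary coframe chosen at `s`.

Honest scope: pointwise linear algebra at one point; the passage from the coframe of `T_sS` to the
six coefficients is row 45; the manifold and the bundles stay prose. Nothing automorphic.
-/

namespace Summit.Ventures.HodgeRepro2.T5ComplexLinearChange

open Matrix Complex T5HodgeStar T5KahlerModel T5CoframeInvariance T5HodgeStarEquivariance

/-- The real `4 × 4` matrix of a complex `2 × 2` matrix `A`, acting on the real coordinates
`(x₁, y₁, x₂, y₂)` of `(z₁, z₂) ∈ ℂ²` (`z_k = x_k + i y_k`): each entry `A_jk` becomes the block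
`[[Re A_jk, −Im A_jk], [Im A_jk, Re A_jk]]`. -/
def realify (A : Matrix (Fin 2) (Fin 2) ℂ) : Matrix (Fin 4) (Fin 4) ℝ :=
  !![(A 0 0).re, -(A 0 0).im, (A 0 1).re, -(A 0 1).im;
     (A 0 0).im, (A 0 0).re, (A 0 1).im, (A 0 1).re;
     (A 1 0).re, -(A 1 0).im, (A 1 1).re, -(A 1 1).im;
     (A 1 0).im, (A 1 0).re, (A 1 1).im, (A 1 1).re]

/-- `realify` is multiplicative. -/
theorem realify_mul (A B : Matrix (Fin 2) (Fin 2) ℂ) : realify (A * B) = realify A * realify B := by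
  ext i j
  fin_cases i <;> fin_cases j <;>
    simp [realify, Matrix.mul_apply, Fin.sum_univ_two, Fin.sum_univ_four] <;> ring

/-- `realify 1 = 1`. -/
theorem realify_one : realify 1 = 1 := by
  ext i j
  fin_cases i <;> fin_cases j <;> simp [realify]

/-- `realify` turns the conjugate transpose into the transpose. -/
theorem realify_conjTranspose (A : Matrix (Fin 2) (Fin 2) ℂ) : realify Aᴴ = (realify A)ᵀ := by
  ext i j
  fin_cases i <;> fin_cases j <;> simp [realify, Matrix.conjTranspose_apply]

/-- A unitary `A` (`Aᴴ A = 1`) has an orthogonal realification. -/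
theorem realify_orthogonal (A : Matrix (Fin 2) (Fin 2) ℂ) (hA : Aᴴ * A = 1) :
    (realify A)ᵀ * realify A = 1 := by
  rw [← realify_conjTranspose, ← realify_mul, hA, realify_one]

/-- `det (realify A) = |det A|²`: every complex-linear change of coframe preserves the orientation —
the complex orientation is canonical (Voisin p0063 l. 23; abstract form: row 25). -/
theorem det_realify (A : Matrix (Fin 2) (Fin 2) ℂ) : (realify A).det = normSq A.det := by
  rw [T5WedgeDeterminant.det_fin_four, Matrix.det_fin_two, normSq_apply]
  simp [realify]
  ring

/-- For a unitary `A`, `|det A|² = 1`. -/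
theorem normSq_det_of_unitary (A : Matrix (Fin 2) (Fin 2) ℂ) (hA : Aᴴ * A = 1) :
    normSq A.det = 1 := by
  have h := congrArg Matrix.det hA
  rw [det_mul, det_conjTranspose, det_one] at h
  have h' : (starRingEnd ℂ) A.det * A.det = 1 := h
  rw [mul_comm, mul_conj] at h'
  exact_mod_cast h'

/-- For a unitary `A`, `det (realify A) = 1`: a unitary change is a positively oriented orthonormal
change of the real coframe. -/
theorem det_realify_of_unitary (A : Matrix (Fin 2) (Fin 2) ℂ) (hA : Aᴴ * A = 1) :
    (realify A).det = 1 := by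
  rw [det_realify, normSq_det_of_unitary A hA]

/-- `dz'_1 ∧ dz'_2 = det A · dz_1 ∧ dz_2`: the `(2,0)`-line is the same for every complex coframe. -/
theorem act_realify_dz12 (A : Matrix (Fin 2) (Fin 2) ℂ) :
    act (realify A)ᵀ dz12 = A.det • dz12 := by
  funext K
  fin_cases K <;> apply Complex.ext <;>
    simp [act, compoundC, compound, minor, pairs, realify, mulVec, dotProduct, Fin.sum_univ_six,
      dz12, Matrix.det_fin_two] <;> ring

/-- A `(2,0)`-covector stays a `(2,0)`-covector (scaled by `det A`). -/
theorem act_realify_twoZero (A : Matrix (Fin 2) (Fin 2) ℂ) (b : ℂ) :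
    act (realify A)ᵀ (twoZero b) = twoZero (A.det * b) := by
  have h := act_realify_dz12 A
  simp only [twoZero, act] at h ⊢
  rw [mulVec_smul, h, smul_smul, mul_comm]

/-- `Σ_ij c_ij dz'_i ∧ dz̄'_j = Σ_kl (Σ_ij A_ik c_ij \overline{A_jl}) dz_k ∧ dz̄_l`: the `(1,1)`-type is
preserved by every complex-linear change of coframe. -/
theorem act_realify_oneOne (A : Matrix (Fin 2) (Fin 2) ℂ) (c : Fin 2 → Fin 2 → ℂ) :
    act (realify A)ᵀ (oneOne c) =
      oneOne fun k l => ∑ i, ∑ j, A i k * c i j * (starRingEnd ℂ) (A j l) := by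
  funext K
  fin_cases K <;> apply Complex.ext <;>
    simp [act, compoundC, compound, minor, pairs, realify, mulVec, dotProduct, Fin.sum_univ_six,
      Fin.sum_univ_two, oneOne, dz1dzbar1, dz1dzbar2, dz2dzbar1, dz2dzbar2] <;> ring

/-- For a unitary `A`, `Σ_i A_ik \overline{A_il} = δ_kl`. -/
theorem sum_mul_conj_of_unitary (A : Matrix (Fin 2) (Fin 2) ℂ) (hA : Aᴴ * A = 1) (k l : Fin 2) :
    ∑ i, A i k * (starRingEnd ℂ) (A i l) = if k = l then 1 else 0 := by
  have h := congrFun (congrFun hA k) l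
  simp only [Matrix.mul_apply, Matrix.conjTranspose_apply, Matrix.one_apply] at h
  have h' := congrArg (starRingEnd ℂ) h
  simp only [map_sum, map_mul, Complex.conj_conj, star_def] at h'
  rw [h']
  split_ifs <;> simp

/-- For a unitary `A`, the Kähler form `ω = (i/2) Σ_k dz_k ∧ dz̄_k` is the same covector in the new
coframe: the model's `kahler` depends only on the hermitian metric. -/
theorem act_realify_kahler (A : Matrix (Fin 2) (Fin 2) ℂ) (hA : Aᴴ * A = 1) :
    act (realify A)ᵀ kahler = kahler := by
  rw [kahler_eq_oneOne, act_realify_oneOne]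
  congr 1
  funext k l
  have h := sum_mul_conj_of_unitary A hA k l
  simp only [mul_ite, mul_zero, ite_mul, zero_mul, Finset.sum_ite_eq, Finset.mem_univ, if_true]
  rw [show (∑ i, A i k * (I / 2) * (starRingEnd ℂ) (A i l)) =
      (I / 2) * ∑ i, A i k * (starRingEnd ℂ) (A i l) by
        rw [Finset.mul_sum]; exact Finset.sum_congr rfl fun i _ => by ring]
  rw [h]; split_ifs <;> simp

/-- For a unitary `A`, the hermitian form of the model is unchanged. -/
theorem herm_act_realify (A : Matrix (Fin 2) (Fin 2) ℂ) (hA : Aᴴ * A = 1) (x y : TwoCovector) :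
    herm (act (realify A)ᵀ x) (act (realify A)ᵀ y) = herm x y :=
  herm_act (realify A)ᵀ (by rw [transpose_transpose]; exact mul_eq_one_comm.mp (realify_orthogonal A hA)) x y

/-- For a unitary `A`, the Hodge operator of the model is unchanged: `*` depends only on the
hermitian metric and the complex orientation (Voisin Definition 5.3, in the model). -/
theorem hodgeStar_act_realify (A : Matrix (Fin 2) (Fin 2) ℂ) (hA : Aᴴ * A = 1) (x : TwoCovector) :
    hodgeStar (act (realify A)ᵀ x) = act (realify A)ᵀ (hodgeStar x) :=
  hodgeStar_act_of_det_eq_one (realify A)ᵀ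
    (by rw [transpose_transpose]; exact mul_eq_one_comm.mp (realify_orthogonal A hA))
    (by rw [det_transpose, det_realify_of_unitary A hA]) x

/-- For ANY complex-linear change (two different hermitian metrics at `s`, each with its unitary
coframe), the hermitian product of two `(2,0)`-covectors scales by `det (realify A) = |det A|²` —
exactly as `Vol` does — so `(α, β)_s Vol_s = α ∧ β̄` is the same for every hermitian metric:
§H2.2's «the L² inner product of two `(2,0)`-forms does not depend on the metric», pointwise. -/
theorem herm_act_realify_twoZero (A : Matrix (Fin 2) (Fin 2) ℂ) (a b : ℂ) :
    herm (act (realify A)ᵀ (twoZero a)) (act (realify A)ᵀ (twoZero b)) =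
      ((realify A).det : ℂ) * herm (twoZero a) (twoZero b) := by
  rw [act_realify_twoZero, act_realify_twoZero, herm_twoZero, herm_twoZero, det_realify,
    ← Complex.mul_conj, map_mul]
  ring

end Summit.Ventures.HodgeRepro2.T5ComplexLinearChange
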